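import Literature.Analysis.FluidPDE.NSUnconditionalUniquenessHolds
import Literature.Analysis.FluidPDE.TaoLocalisation
import Literature.Analysis.FluidPDE.EnstrophySplitting

/-!
# `X5b` — Clay-class uniqueness against the classical Leray–Hopf solution (stmt-NavierStokesRegularity-0153)

The shared support item `X5b` of the negative-side Navier–Stokes routes (`Blowup.BlowupClayUniqueness`,
`AdiabaticEddy.ClayUniqueness`, `CertifiedBlowup.BlowupClayUniqueness`, `DssFarFieldSlaving.ClayUniqueness`,
… — one statement, stmt-NavierStokesRegularity-0153):

  a Fefferman class-(A) solution `(u, p)` (jointly `C^∞` on `ℝ³ × [0, ∞)`, `sup_t ∫ |u|² < ∞`, nothing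
  else) from a rapidly decaying datum `u₀` coincides on `[0, T)` with every classical solution `(v, q)`
  on `ℝ³ × [0, T)` that is Leray–Hopf from `u₀`.

This module proves the statement in RAW form (`blowup_clay_uniqueness`, the item's registered name),
importing no route file, so that every wanting route file can link its `_holds` to a module that does
not (transitively) import a `Theses` file; the per-route closing theorem
(`adiabaticEddy_clayUniqueness_proof`, file `AdiabaticEddyClayUniqueness.lean`) is this theorem by `Iff.rfl`.

## Proof

T. Tao, *Localisation and compactness properties of the Navier–Stokes global regularity problem*,
Anal. PDE 6 (2013) = arXiv:1108.1165, Cor. 11.4 (arXiv Cor. 71, p. 36): smooth `H¹` data admit at most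
one almost smooth finite-energy solution on a closed slab — in tree, DISCHARGED, velocity form:
`Literature.Analysis.FluidPDE.tao_unconditional_uniqueness_velocity_holds` (axioms standard).  Glue: for
`t ∈ (0, T)` both `(u, p)` (wave-0 predicate + joint smoothness = classical solution on `Ici 0`,
restricted to `Icc 0 t`) and `(v, q)` (restricted `Ico 0 T → Icc 0 t`) are classical finite-energy
solutions on the CLOSED slab `[0, t] × ℝ³` (energy of `v` from the Leray–Hopf energy inequality,
`IsLerayHopfOn.lintegral_enorm_sq_le`); the rapidly decaying datum is `H¹`
(`HasRapidSpatialDecay.lintegral_enorm_iteratedFDeriv_sq_lt_top`, `n = 0, 1`); Tao's theorem gives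
`u t = v t`.  At `t = 0` both slices are the datum.  (Same argument as the accepted refutation
`BlowupBlowupClayNonuniqueness_refuted` of the loophole item stmt-…-0154, refuter seat
rreview1-Blowup-0420b48a, from which the `H¹`-datum bookkeeping lemma below is adapted; `L²`-finiteness bookkeeping is the tree's
`Literature.Analysis.FluidPDE.eLpNorm_two_lt_top_of_lintegral_enorm_sq_lt_top`; restated here
without the `Theses.Blowup` import.)
-/

noncomputable section

-- the summit-side namespace `Summit.NavierStokesRegularity.NavierStokesRegularity.…` repeats a component by design (D-0017)
set_option linter.dupNamespace false

namespace Summit.NavierStokesRegularity.NavierStokesRegularity.Theorems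

open Set MeasureTheory Filter Topology
open scoped ENNReal ContDiff
open Literature.Analysis.FluidPDE

/-- **A rapidly decaying `C¹` field is in `H¹`** (`u₀ ∈ L²`, `∇u₀ ∈ L²`): Fefferman's decay (4) makes
every `Dⁿu₀` square integrable (`HasRapidSpatialDecay.lintegral_enorm_iteratedFDeriv_sq_lt_top`,
Tao 2013 §1 p. 3 "Schwartz implies `H¹`"); measurability from continuity of `u₀` and of `fderiv ℝ u₀`.
[folklore] -/
theorem ClayUniqueness.memLp_two_of_rapidDecay
    {u₀ : EuclideanSpace ℝ (Fin 3) → EuclideanSpace ℝ (Fin 3)} (hdec : HasRapidSpatialDecay u₀)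
    (hC1 : ContDiff ℝ 1 u₀) : MemLp u₀ 2 volume ∧ MemLp (fderiv ℝ u₀) 2 volume := by
  have hH : ∀ n : ℕ, ∫⁻ x, ‖iteratedFDeriv ℝ n u₀ x‖ₑ ^ 2 < ⊤ :=
    hdec.lintegral_enorm_iteratedFDeriv_sq_lt_top (μ := volume)
  have h0 : ∫⁻ x, ‖u₀ x‖ₑ ^ 2 < ⊤ := by
    refine lt_of_le_of_lt (le_of_eq (lintegral_congr fun x => ?_)) (hH 0)
    rw [← ofReal_norm, ← ofReal_norm, norm_iteratedFDeriv_zero]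
  have h1 : ∫⁻ x, ‖fderiv ℝ u₀ x‖ₑ ^ 2 < ⊤ := by
    refine lt_of_le_of_lt (le_of_eq (lintegral_congr fun x => ?_)) (hH 1)
    rw [← ofReal_norm, ← ofReal_norm, norm_iteratedFDeriv_one]
  exact ⟨⟨hC1.continuous.aestronglyMeasurable, eLpNorm_two_lt_top_of_lintegral_enorm_sq_lt_top h0⟩,
    ⟨(hC1.continuous_fderiv one_ne_zero).aestronglyMeasurable,
      eLpNorm_two_lt_top_of_lintegral_enorm_sq_lt_top h1⟩⟩

/-- **`X5b` (stmt-NavierStokesRegularity-0153), raw form: Clay class (A) from a rapidly decaying datum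
is a uniqueness class against the classical Leray–Hopf solution.**  For `ν > 0`, a rapidly decaying
datum `u₀`, a wave-0 Clay solution `(u, p)` (`IsNavierStokesSolution ν 0 u₀ u p`, `u`, `p` jointly smooth
on `[0, ∞) × ℝ³`, bounded energy) and a classical solution `(v, q)` on `[0, T)` that is Leray–Hopf from
`u₀` with `v 0 = u₀`: `u t = v t` for every `t ∈ [0, T)`.  Proof: `t = 0` by the initial conditions;
for `0 < t < T` apply Tao 2013 Cor. 11.4 (`tao_unconditional_uniqueness_velocity_holds`) on the closed
slab `[0, t]` — both restrictions are classical with finite energy there and the datum is `H¹`.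
This is, verbatim, the body of every route decl wanting the item (`AdiabaticEddy.ClayUniqueness`,
`Blowup.BlowupClayUniqueness`, …). [cite: Tao2011, Cor. 11.4 (arXiv:1108.1165 Cor. 71, p. 36)] -/
theorem blowup_clay_uniqueness :
    ∀ ν : ℝ, 0 < ν → ∀ (u₀ : EuclideanSpace ℝ (Fin 3) → EuclideanSpace ℝ (Fin 3)),
      HasRapidSpatialDecay u₀ →
      ∀ (u v : ℝ → EuclideanSpace ℝ (Fin 3) → EuclideanSpace ℝ (Fin 3))
        (p q : ℝ → EuclideanSpace ℝ (Fin 3) → ℝ) (T : ℝ), 0 < T →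
        IsSmoothOnHalfSpace u → IsSmoothOnHalfSpace p → IsNavierStokesSolution ν 0 u₀ u p →
        HasBoundedEnergy u → IsClassicalNSSolutionOn (Set.Ico 0 T) ν 0 v q →
        IsLerayHopfOn T ν 0 u₀ v → v 0 = u₀ → ∀ t ∈ Set.Ico 0 T, u t = v t := by
  intro ν hν u₀ hdec u v p q T hT hu hp hns hbe hcl hLH hv0 t ht
  obtain ⟨ht0, htT⟩ := ht
  rcases ht0.eq_or_lt with h00 | ht0'
  · -- `t = 0`: both slices are the datum
    subst h00
    rw [hns.initial, hv0]
  · -- `0 < t < T`: Tao's unconditional uniqueness on the closed slab `[0, t]`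
    -- the wave-0 predicate plus joint smoothness is a classical solution on `Ici 0` (bridge, field by field)
    have hclu : IsClassicalNSSolutionOn (Ici 0) ν 0 u p :=
      ⟨hu, hp, fun s hs x => hns.momentum s hs x, fun s hs => hns.divFree s hs⟩
    have hu' : IsClassicalNSSolutionOn (Icc 0 t) ν 0 u p :=
      hclu.mono (fun s hs => hs.1) (uniqueDiffOn_Icc ht0')
    have hv' : IsClassicalNSSolutionOn (Icc 0 t) ν 0 v q :=
      hcl.mono (fun s hs => ⟨hs.1, lt_of_le_of_lt hs.2 htT⟩) (uniqueDiffOn_Icc ht0')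
    -- the datum is `C¹` (it is the smooth slice `u 0`) and rapidly decaying, hence `H¹`
    have hC1 : ContDiff ℝ 1 u₀ := by
      have h := hclu.contDiff_velocity (t := 0) (by simp)
      rw [hns.initial] at h
      exact h.of_le (by norm_cast)
    obtain ⟨hL2, hH1⟩ := ClayUniqueness.memLp_two_of_rapidDecay hdec hC1
    -- finite energy of the Clay-class solution on `[0, t]`
    have hEu : ∃ C : ℝ≥0∞, C < ⊤ ∧ ∀ s ∈ Icc 0 t, ∫⁻ x, ‖u s x‖ₑ ^ 2 ≤ C := by
      obtain ⟨C, hC, hb⟩ := hbe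
      exact ⟨C, hC, fun s hs => hb s hs.1⟩
    -- finite energy of the Leray–Hopf partner on `[0, t]` (energy inequality from `s = 0`, `f = 0`)
    have hEv : ∃ C : ℝ≥0∞, C < ⊤ ∧ ∀ s ∈ Icc 0 t, ∫⁻ x, ‖v s x‖ₑ ^ 2 ≤ C :=
      ⟨ENNReal.ofReal (2 * VectorCalculus.kineticEnergy u₀), ENNReal.ofReal_lt_top,
        fun s hs => hLH.lintegral_enorm_sq_le hν.le ⟨hs.1, hs.2.trans htT.le⟩⟩
    exact tao_unconditional_uniqueness_velocity_holds ν t hν ht0' u₀ hL2 hH1 u v p q hu' hv'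
      hns.initial hv0 hEu hEv t ⟨ht0, le_rfl⟩

end Summit.NavierStokesRegularity.NavierStokesRegularity.Theorems

end
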